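import Literature.AlgebraicGeometry.Modules.SerreTwistHyperplaneClass
import Literature.AlgebraicGeometry.Modules.SerreTwistHom
import Literature.AlgebraicGeometry.Motives.GeneratingSectionsToProjRatios
import Literature.AlgebraicGeometry.Motives.GeneratingSectionsOfLineBundle
import Literature.AlgebraicGeometry.AbelianVarieties.LineBundleTensorPower
import HarnessLib

/-!
# The Serre twists along the morphism defined by a line bundle: `φ_E^*𝒪(n) ≅ E^{⊗n}` (Hartshorne II Thm. 7.1, module half)

Layer `Literature/AlgebraicGeometry/Motives`, namespace `Literature.AlgebraicGeometry.Motives.GeneratingSections`.  THEOREMS ONLY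
(no definition, no named fact, no instance, no notation, no `sorry`).  Cell `hodgecm-mathlib` (D-0151), F-DAG F-6 (H-rep) brick
(R4-poly), generic half (B-p11 (g18); census-lite STATUS 10:59:17Z / 11:03:22Z; consumer
`ModuliOfAbelianVarieties/SiegelLinearRigidificationHilbertPolynomial`).  Count-neutral capital: HC_CM is proved only modulo the 7
printed citations until rung 0 closes — nothing here bears on a summit statement.

[Hartshorne1977] II Thm. 7.1: a morphism `φ : X → ℙʳ_A` with `φ^*𝒪(1) ≅ E` is the same as a line bundle `E` with `r + 1`
generating global sections.  The tree writes «the morphism defined by `E` and sections `t₀, …, t_r`» as `D.toProj f` for the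
sheaf-free datum `D := ofCocycleSections F.U (CocycleSections.ofFrameSystem F h1 t) hcov` of a rank-one frame system `F` of `E`
(★ `Motives/GeneratingSectionsOfLineBundle`), and `𝒪_X(n)` along a morphism `φ : X → 𝐏ʳ_A` as the Serre twists ★
`SerreTwist.serreTwist φ n = 𝒪_X(-n)`, ★ `SerreTwist.twistMod φ N n = N(n)` (★ `Modules/SerreTwist`, `SerreTwistMod`).  This file
proves the MODULE half of II Thm. 7.1 in this currency, on an ARBITRARY scheme (no integrality, no divisors), by a Čech-cocycle
comparison:

* §1 `detClass_serreTwist_toProj` — `[𝒪_X(-n)] = [E]^{-n}` in `Ȟ¹(X, 𝒪_X^×)`: the chart frames of `𝒪_X(-n)` along `φ = D.toProj f`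
  (★ `transitionDet_chartFrame`: transition functions `(x_a/x_b)^n ∘ φ`) have the cocycle `(t_a/t_b)^n` (★ `map_homRatio_eq_map_chartFun`,
  ★ `homRatio_toProj`, ★ `ofCocycleSections_ratio_res_mul`), which is cohomologous to the inverse `n`-th power of the frame cocycle of
  `E` through the unit coefficients `coeffAt (a x) x` (★ `map_coeffAt_eq`).
* §2 **`nonempty_twistMod_toProj_iso_tensorPow`** — hence `𝒪_X(n) := twistMod φ 𝒪_X n ≅ E^{⊗n}` (★ `sheafHomTwistIso`,
  ★ `detClass_dual`, ★ `detClass_tensorPow`, ★ `nonempty_iso_iff_detClass_eq`); `nonempty_twistMod_toProj_iso` — `n = 1`.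

## References
* [Hartshorne1977] R. Hartshorne, *Algebraic Geometry* (1977), II Thm. 7.1 (p. 150); II Prop. 5.12 (p. 117); II Ex. 5.16 (d),
  Ex. 6.11; III Ex. 4.5 (`Pic X ≅ Ȟ¹(X, 𝒪_X^×)`).
* [GortzWedhorn2020] U. Görtz, T. Wedhorn, *Algebraic Geometry I: Schemes*, 2nd ed. (2020), Prop. 11.15, (11.7), Section (13.8).
-/

noncomputable section

-- `TopCat.Presheaf`/`Scheme.Modules` are not reducible (as in Mathlib's `AlgebraicGeometry/Modules/Sheaf.lean`).
set_option backward.isDefEq.respectTransparency false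

universe u

open CategoryTheory AlgebraicGeometry TopologicalSpace Opposite
open Literature.AlgebraicGeometry.Modules Literature.AlgebraicGeometry.Modules.SerreTwist
open Literature.AlgebraicGeometry.Morphisms Literature.AlgebraicGeometry.Morphisms.ProjCech


namespace Literature.AlgebraicGeometry.Motives

namespace GeneratingSections

variable {A : Type u} [CommRing A] {r : ℕ} {X : Scheme.{u}} (f : X ⟶ Spec (.of A))
  {E : X.Modules} (F : FrameSystem E) (h1 : ∀ x, F.rank x = 1) (t : Fin (r + 1) → Γ(E, ⊤))
  (hcov : ⨆ i, ⨆ x, X.basicOpen ((CocycleSections.ofFrameSystem F h1 t).coeff i x) = ⊤)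

/-! ## §1 The class of `𝒪_X(-n)` along `φ = D.toProj f` -/

/-- Two-step restriction of `𝒪_X` equals the one-step restriction. [folklore] -/
private theorem res_res {U V W : X.Opens} (h₁ : V ≤ U) (h₂ : W ≤ V) (s : Γ(X, U)) :
    X.presheaf.map (homOfLE h₂).op (X.presheaf.map (homOfLE h₁).op s) = X.presheaf.map (homOfLE (h₂.trans h₁)).op s := by
  rw [← CommRingCat.comp_apply, ← Functor.map_comp]
  rfl

/-- **`[𝒪_X(-n)] = [E]^{-n}` in `Ȟ¹(X, 𝒪_X^×)`** for `φ = D.toProj f` the morphism defined by the line bundle `E` (frame system `F`)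
and generating sections `t` ([Hartshorne1977] II Thm. 7.1 (b) «`φ^*𝒪(1) ≅ 𝓛`», read on classes; II Ex. 5.16 (d) / Ex. 6.11):
the chart frame system of `𝒪_X(-n)` at the chart `a(x)` with `x ∈ X_{coeffAt (a x) x}` has transition functions
`((x_{a x}/x_{a y}) ∘ φ)^n = (t_{a x}/t_{a y})^n`, and `t_{a x}/t_{a y} = c_{a x}(x) g_{yx} c_{a y}(y)⁻¹` with the unit coefficients
`c_a(z) = coeffAt a z` — a coboundary to the inverse `n`-th power of the frame cocycle `g` of `E`.
[cite: Hartshorne1977, II Thm. 7.1 (p. 150)] [cite: Hartshorne1977, II Prop. 5.12 (p. 117)] -/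
theorem detClass_serreTwist_toProj (n : ℕ) :
    detClass (isFiniteLocallyFree_serreTwist
        (ofCocycleSections F.U (CocycleSections.ofFrameSystem F h1 t) hcov |>.toProj f : X ⟶ PP A r) n) =
      ((CechPic.mk F.cocycle)⁻¹) ^ n := by
  classical
  set D := ofCocycleSections F.U (CocycleSections.ofFrameSystem F h1 t) hcov with hD
  set φ : X ⟶ PP A r := D.toProj f with hφ
  -- chart choice: `x ∈ X_{c_{a x}(x)}` (the sections generate)
  have hgen := (iSup_basicOpen_coeffAt_eq_top_iff F h1 t).mp hcov
  choose a ha using hgen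
  -- `X_{c_a(x)} ≤ U_a = φ⁻¹ D₊(x_a) = Z_a`
  have hUa : ∀ b, D.U b = Zop φ {b} := fun b => by
    rw [Zop_singleton_eq_preU]
    exact (D.toProj_preimage_basicOpen f b).symm
  have hbU : ∀ b x, X.basicOpen (coeffAt F h1 t b x) ≤ Zop φ {b} := fun b x => by
    rw [← hUa]; exact basicOpen_le_ofCocycleSections_U F.U _ hcov b x
  -- the chart frame system of `𝒪_X(-n)`
  let G : FrameSystem (serreTwist φ n) :=
    { U := fun x => Zop φ {a x}
      mem := fun x => hbU _ _ (ha x)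
      I := fun _ => PUnit.{u + 1}
      rank := fun _ => 1
      enum := fun _ => _root_.Equiv.ofUnique PUnit (Fin 1)
      frame := fun x => freePUnitIso (Zop φ {a x}) ≪≫ (overIsoUnit φ n (a x)).symm }
  have hGg : ∀ (x y : X) (V : X.Opens) (hx : V ≤ Zop φ {a x}) (hy : V ≤ Zop φ {a y}),
      G.cocycle.g x y V hx hy = X.presheaf.map (homOfLE hy).op (SerreTwist.chartFun φ (a x) (a y)) ^ n :=
    fun x y V hx hy => transitionDet_chartFrame φ n (a x) (a y) hx hy
  -- the inverse `m`-th powers of the frame cocycle of `E`, as cocycles, and their classes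
  let cpow : ℕ → UnitCocycle X := fun m =>
    { U := F.U
      mem := F.mem
      g := fun x y V hx hy => F.cocycle.g y x V hy hx ^ m
      map_g := fun x y V V' hx hy i => by
        change X.presheaf.map (homOfLE i).op (F.cocycle.g y x V hy hx ^ m) = _
        rw [map_pow]
        exact congrArg (· ^ m) (F.cocycle.map_g y x hy hx i)
      g_mul := fun x y z V hx hy hz => by rw [← mul_pow, mul_comm, F.cocycle.g_mul]
      g_self := fun x V hx => by rw [F.cocycle.g_self, one_pow] }
  have hc : ∀ m : ℕ, CechPic.mk (cpow m) = ((CechPic.mk F.cocycle)⁻¹) ^ m := by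
    intro m
    induction m with
    | zero =>
      rw [pow_zero, ← CechPic.mk_one]
      exact CechPic.sound (UnitCocycle.equiv_of_eq _ _ F.U F.mem (fun _ => le_rfl) (fun _ => le_top)
        fun x y V hx hy => by change (1 : Γ(X, V)) = F.cocycle.g y x V _ _ ^ 0; rw [pow_zero])
    | succ m ih =>
      rw [pow_succ, ← ih, ← CechPic.mk_inv, ← CechPic.mk_mul]
      refine CechPic.sound (UnitCocycle.equiv_of_eq _ _ F.U F.mem (fun _ => le_rfl) (fun _ => le_inf le_rfl le_rfl) ?_)
      intro x y V hx hy
      change F.cocycle.g y x V _ _ ^ m * F.cocycle.g y x V _ _ = F.cocycle.g y x V _ _ ^ (m + 1)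
      rw [pow_succ]
  -- the comparison
  rw [detClass_eq_mk _ G, ← hc n]
  refine (CechPic.sound ?_).symm
  -- coboundary `c ~ G.cocycle` on `W x := U_x ∩ X_{c_{a x}(x)}` with `λ_x := c_{a x}(x)^n`
  refine ⟨{ W := fun x => F.U x ⊓ X.basicOpen (coeffAt F h1 t (a x) x)
            mem := fun x => ⟨F.mem x, ha x⟩
            le := fun x => inf_le_left
            le' := fun x => inf_le_right.trans (hbU _ _)
            lam := fun x V hV => X.presheaf.map (homOfLE (hV.trans inf_le_left)).op (coeffAt F h1 t (a x) x) ^ n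
            inv := fun x V hV => Ring.inverse (X.presheaf.map (homOfLE (hV.trans inf_le_left)).op (coeffAt F h1 t (a x) x) ^ n)
            map_lam := fun x V V' hV i => by
              change X.presheaf.map (homOfLE i).op (_ ^ n) = _
              rw [map_pow, res_res]
            lam_mul_inv := fun x V hV => Ring.mul_inverse_cancel _ (IsUnit.pow n ?_)
            rel := fun x y V hx hy => ?_ }⟩
  · -- `c_{a x}(x)` is a unit on `X_{c_{a x}(x)} ⊇ V`
    have hu := AlgebraicGeometry.Scheme.basicOpen_le X (coeffAt F h1 t (a x) x)
    have hVb : V ≤ X.basicOpen (coeffAt F h1 t (a x) x) := hV.trans inf_le_right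
    have h₀ : IsUnit (X.presheaf.map (homOfLE hu).op (coeffAt F h1 t (a x) x)) :=
      RingedSpace.isUnit_res_basicOpen X.toRingedSpace (coeffAt F h1 t (a x) x)
    have := h₀.map (X.presheaf.map (homOfLE hVb).op).hom
    rwa [res_res] at this
  · -- the coboundary relation `(x_{a x}/x_{a y} ∘ φ)^n · c_{a y}(y)^n = c_{a x}(x)^n · g_{yx}^n` on `V`
    change G.cocycle.g x y V _ _ * _ ^ n = _ ^ n * F.cocycle.g y x V _ _ ^ n
    rw [hGg, ← mul_pow, ← mul_pow]
    congr 1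
    -- (i) the chart function is the ratio `t_{a x}/t_{a y}` of `D`
    have hVy : V ≤ X.basicOpen (coeffAt F h1 t (a y) y) := hy.trans inf_le_right
    have hVUy : V ≤ D.U (a y) := hVy.trans (basicOpen_le_ofCocycleSections_U F.U _ hcov (a y) y)
    have hVpre : V ≤ preU φ (a y) := by rw [← Zop_singleton_eq_preU, ← hUa]; exact hVUy
    have e1 : X.presheaf.map (homOfLE (hy.trans (inf_le_right.trans (hbU _ _)))).op (SerreTwist.chartFun φ (a x) (a y)) =
        X.presheaf.map (homOfLE hVUy).op (D.ratio (a y) (a x)) := by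
      rw [← map_homRatio_eq_map_chartFun φ (a y) (a x) hVpre, homRatio_toProj, res_res]
    -- (ii) `ratio (a y) (a x) · c_{a y}(y) = c_{a x}(y)` on `X_{c_{a y}(y)} ⊇ V`
    have hVFy : V ≤ F.U y := hy.trans inf_le_left
    have hVFx : V ≤ F.U x := hx.trans inf_le_left
    have e2 : X.presheaf.map (homOfLE hVUy).op (D.ratio (a y) (a x)) *
        X.presheaf.map (homOfLE hVFy).op (coeffAt F h1 t (a y) y) =
        X.presheaf.map (homOfLE hVFy).op (coeffAt F h1 t (a x) y) := by
      have h := congrArg (X.presheaf.map (homOfLE hVy).op)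
        (ofCocycleSections_ratio_res_mul F.U (CocycleSections.ofFrameSystem F h1 t) hcov (a y) (a x) y)
      rw [map_mul] at h
      simp only [CocycleSections.ofFrameSystem_coeff, ← CommRingCat.comp_apply, ← Functor.map_comp] at h
      exact h
    -- (iii) `c_{a x}(y) = c_{a x}(x) · g_{yx}` on `V`
    have e3 := map_coeffAt_eq F h1 t (a x) y x hVFy hVFx
    rw [e1, e2, e3]

/-! ## §2 `𝒪_X(n) ≅ E^{⊗n}` -/

/-- **[Hartshorne1977] II Thm. 7.1, MODULE HALF: `φ_E^*𝒪(n) ≅ E^{⊗n}`** — for the morphism `φ = D.toProj f : X → 𝐏ʳ_A` defined by a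
line bundle `E` (frame system `F`) and generating sections `t₀, …, t_r`, the Serre twist `𝒪_X(n) = twistMod φ 𝒪_X n` (the dual of
`𝒪_X(-n)`, ★ `sheafHomTwistIso`) is isomorphic to `E^{⊗n}`: both have rank one and the class `[E]ⁿ` (§1, ★ `detClass_dual`,
★ `detClass_tensorPow`, ★ `nonempty_iso_iff_detClass_eq`).  Arbitrary scheme `X`.
[cite: Hartshorne1977, II Thm. 7.1 (p. 150)] [cite: Hartshorne1977, III Ex. 4.5] -/
theorem nonempty_twistMod_toProj_iso_tensorPow (n : ℕ) :
    Nonempty (twistMod (ofCocycleSections F.U (CocycleSections.ofFrameSystem F h1 t) hcov |>.toProj f : X ⟶ PP A r)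
        (unitModule X) n ≅ tensorPow E n) := by
  set φ : X ⟶ PP A r := (ofCocycleSections F.U (CocycleSections.ofFrameSystem F h1 t) hcov).toProj f with hφ
  have hE1 : HasRank E 1 := F.hasRank 1 h1
  have hE : IsFiniteLocallyFree E := F.isFiniteLocallyFree
  have hS := isFiniteLocallyFree_serreTwist φ n
  have hSd := isFiniteLocallyFree_dual hS
  obtain ⟨e⟩ : Nonempty (Modules.dual (serreTwist φ n) ≅ tensorPow E n) := by
    refine (nonempty_iso_iff_detClass_eq (hasRank_dual (hasRank_serreTwist φ n)) (hasRank_tensorPow_one hE1 n) hSd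
      (isFiniteLocallyFree_tensorPow hE n)).2 ?_
    rw [detClass_dual hS, detClass_serreTwist_toProj f F h1 t hcov n, detClass_tensorPow hE1 hE n, inv_pow, inv_inv,
      detClass_eq_mk hE F]
  exact ⟨(sheafHomTwistIso φ (unitModule X) n).symm ≪≫ e⟩

/-- **`φ_E^*𝒪(1) ≅ E`** (the case `n = 1` of `nonempty_twistMod_toProj_iso_tensorPow`; `E^{⊗1} = E ⊗ 𝒪 ≅ E`).
[cite: Hartshorne1977, II Thm. 7.1 (p. 150)] -/
theorem nonempty_twistMod_toProj_iso :
    Nonempty (twistMod (ofCocycleSections F.U (CocycleSections.ofFrameSystem F h1 t) hcov |>.toProj f : X ⟶ PP A r)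
        (unitModule X) 1 ≅ E) := by
  set φ : X ⟶ PP A r := (ofCocycleSections F.U (CocycleSections.ofFrameSystem F h1 t) hcov).toProj f with hφ
  have hE1 : HasRank E 1 := F.hasRank 1 h1
  have hE : IsFiniteLocallyFree E := F.isFiniteLocallyFree
  have hS := isFiniteLocallyFree_serreTwist φ 1
  have hSd := isFiniteLocallyFree_dual hS
  obtain ⟨e⟩ : Nonempty (Modules.dual (serreTwist φ 1) ≅ E) := by
    refine (nonempty_iso_iff_detClass_eq (hasRank_dual (hasRank_serreTwist φ 1)) hE1 hSd hE).2 ?_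
    rw [detClass_dual hS, detClass_serreTwist_toProj f F h1 t hcov 1, pow_one, inv_inv, detClass_eq_mk hE F]
  exact ⟨(sheafHomTwistIso φ (unitModule X) 1).symm ≪≫ e⟩

end GeneratingSections

end Literature.AlgebraicGeometry.Motives

end
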